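import Literature.MathematicalPhysics.QuantumFieldTheory.WilsonPartitionHironakaForm
import HarnessLib

/-!
# Laplace asymptotics from resolution data AT the zeros of the phase (pointwise chain)

The tree reduces `WilsonPartitionRegularVariation` to Hironaka's theorem stated UNIVERSALLY
(`wilsonPartitionRegularVariation_of_resolutionOfSingularities`: resolution of every finite family
of real-analytic functions). Its proof, however, only resolves very particular families: at a zero
`x` of the phase `f` on the compact semianalytic set `Ω = {gⱼ ≥ 0}`, the family `(f, gⱼ or f)`
read in an affine chart centred at `x`. This file records the same chain of PROVED reductions in
pointwise form, so that the resolution data can be supplied zero by zero, and for these families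
only (as the algebraic resolution of singularities of the tree does for the Wilson action, whose
phase and constraint are regular functions in suitable analytic coordinates):

* `localMonomialization_at` — local monomialization of the weighted sublevel integrals at a zero
  `x`, from resolution data for the families `(f, gⱼ or f) ∘ (v ↦ x + T⁻¹v)` (the proof of the
  tree's `localMonomialization_of_resolution`, verbatim, with the universal hypothesis replaced
  by its instances);
* `laplaceAsymptotics_at` — leading-term asymptotics of `∫_Ω e^{-τ|f|} φ dμ` from the
  monomialization of the sublevel volumes of the given data (the proof of the tree's
  `laplaceAsymptotics_of_monomialization`, verbatim);
* `laplaceAsymptotics_of_localResolution` — the two combined with the base gluing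
  (`MonomialPhase.exists_monomialPieces_of_local`): resolution data at every zero of `f` in `Ω`
  give `τ^λ (log τ)^{-m} ∫_Ω e^{-τ|f|} φ dμ → C > 0`.

Everything is proved; no definitions, no named facts.

## References

* S. Lin, arXiv:1003.5338, Thm. 2.2, Cor. 2.3, Lemma 2.4, Thm. 2.9. [Lin2017]
* S. Watanabe, *Algebraic Geometry and Statistical Learning Theory* (2009), Thm. 2.8.
  [WatanabeSumio2009]
* V. I. Arnold, S. M. Gusein-Zade, A. N. Varchenko, *Singularities of Differentiable Maps II*
  (2012), Part II §6.3 Thm. 6.6, §7.3 Thms. 7.5, 7.6. [ArnoldGuseinzadeVarchenko2012]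
-/

noncomputable section

open Set Filter Metric Function
open _root_.MeasureTheory _root_.Topology
open Literature.Analysis.Asymptotics Literature.Analysis.Asymptotics.MonomialPhase
open Literature.Analysis.Calculus Literature.Analysis.Calculus.Resolution
open scoped ENNReal ContDiff Manifold

namespace Literature.MathematicalPhysics.QuantumFieldTheory

section Local

set_option maxHeartbeats 3200000 in
-- one long assembly proof: reductions (coordinates, translation, degenerate case, active
-- constraints), the resolution data, chart sum, orthant pieces, bookkeeping of the Σ-indexed family
/-- **Local monomialization of weighted sublevel integrals at a zero, from resolution data for
the families built from `f` and the `gⱼ` at that zero.** This is the pointwise form of the tree's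
`localMonomialization_of_resolution` (Lin 2017, proof of Lemma 2.4): the conclusion is the local
monomialization at the zero `x ∈ Ω` of `f` (`Ω = {gⱼ ≥ 0} ⊆ U` compact semianalytic,
`μ(Ω ∩ f⁻¹0) = 0`), and the hypothesis `hRx` is the output of the simultaneous resolution of
singularities (Watanabe 2009 Thm. 2.8; Lin 2017 Thm. 2.2 / Cor. 2.3; AGV II Part II §6.3 Thm. 6.6)
demanded ONLY for families `F₀, …, F_l` on open sets `V ∋ 0` of `ℝ^D` each member of which is
`f` or some `gⱼ` read in an affine chart `v ↦ x + T⁻¹ v` of `E` centred at `x` — which is all the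
proof uses. (So `hRx` can be supplied by any theory resolving these particular functions, e.g.
algebraic resolution when `f`, `gⱼ` are algebraic in suitable analytic coordinates.)
[cite: Lin2017, Thm. 2.2, Cor. 2.3, proof of Lemma 2.4] [cite: WatanabeSumio2009, Thm. 2.8]
[cite: ArnoldGuseinzadeVarchenko2012, Part II §6.3 Thm. 6.6, §7.3 proof of Thm. 7.5] -/
theorem localMonomialization_at
    {E : Type} [NormedAddCommGroup E] [NormedSpace ℝ E] [FiniteDimensional ℝ E]
    [MeasurableSpace E] [BorelSpace E] (μ : Measure E) [μ.IsAddHaarMeasure]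
    {U : Set E} {f : E → ℝ} {l : ℕ} {g : Fin l → E → ℝ} {φ : E → ℝ}
    (hU : IsOpen U) (hf : AnalyticOnNhd ℝ f U) (hg : ∀ j, AnalyticOnNhd ℝ (g j) U)
    (hφ : ContDiffOn ℝ ∞ φ U) (hΩc : IsCompact {x ∈ U | ∀ j, 0 ≤ g j x})
    (hφpos : ∀ x ∈ {x ∈ U | ∀ j, 0 ≤ g j x}, 0 < φ x)
    (hnull : μ {x ∈ U | (∀ j, 0 ≤ g j x) ∧ f x = 0} = 0)
    {x : E} (hx : x ∈ {x ∈ U | ∀ j, 0 ≤ g j x}) (hfx : f x = 0)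
    (hRx : ∀ (T : E ≃L[ℝ] (Fin (Module.finrank ℝ E) → ℝ)) (V : Set (Fin (Module.finrank ℝ E) → ℝ))
      (F : Fin (l + 1) → (Fin (Module.finrank ℝ E) → ℝ) → ℝ),
      IsOpen V → IsPreconnected V → (0 : Fin (Module.finrank ℝ E) → ℝ) ∈ V →
      (∀ i, AnalyticOnNhd ℝ (F i) V) → (∀ i, F i 0 = 0) → (∀ i, ∃ v ∈ V, F i v ≠ 0) →
      (∀ i, (F i = fun v => f (x + T.symm v)) ∨ ∃ j, F i = fun v => g j (x + T.symm v)) →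
      ∃ (W : Set (Fin (Module.finrank ℝ E) → ℝ)) (M : Type) (_ : TopologicalSpace M) (_ : T2Space M)
        (_ : ChartedSpace (Fin (Module.finrank ℝ E) → ℝ) M)
        (_ : IsManifold 𝓘(ℝ, Fin (Module.finrank ℝ E) → ℝ) ω M)
        (gr : M → (Fin (Module.finrank ℝ E) → ℝ)),
        IsOpen W ∧ (0 : Fin (Module.finrank ℝ E) → ℝ) ∈ W ∧ W ⊆ V ∧ (∀ p, gr p ∈ W) ∧
        ContMDiff 𝓘(ℝ, Fin (Module.finrank ℝ E) → ℝ) 𝓘(ℝ, Fin (Module.finrank ℝ E) → ℝ) ω gr ∧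
        (∀ K ⊆ W, IsCompact K → IsCompact (gr ⁻¹' K)) ∧
        Set.BijOn gr {p | ∀ i, F i (gr p) ≠ 0} {x ∈ W | ∀ i, F i x ≠ 0} ∧
        ∀ p : M, (∃ i, F i (gr p) = 0) →
          ∃ ch : OpenPartialHomeomorph M (Fin (Module.finrank ℝ E) → ℝ),
            ch ∈ IsManifold.maximalAtlas 𝓘(ℝ, Fin (Module.finrank ℝ E) → ℝ) ω M ∧
            p ∈ ch.source ∧ ch p = 0 ∧
            ∃ (k : Fin (l + 1) → Fin (Module.finrank ℝ E) → ℕ) (h : Fin (Module.finrank ℝ E) → ℕ)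
              (a : Fin (l + 1) → (Fin (Module.finrank ℝ E) → ℝ) → ℝ)
              (b : (Fin (Module.finrank ℝ E) → ℝ) → ℝ),
              (∀ i, AnalyticOnNhd ℝ (a i) ch.target) ∧ AnalyticOnNhd ℝ b ch.target ∧
              (∀ i, ∀ u ∈ ch.target, a i u ≠ 0) ∧ (∀ u ∈ ch.target, b u ≠ 0) ∧
              (∀ i, ∀ u ∈ ch.target, F i (gr (ch.symm u)) = a i u * ∏ j, u j ^ k i j) ∧
              (∀ u ∈ ch.target, (fderiv ℝ (gr ∘ ch.symm) u).det = b u * ∏ j, u j ^ h j)) :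
    ∃ W : Set E, IsOpen W ∧ x ∈ W ∧
      ∃ (ι : Type) (_ : Fintype ι) (κ w : ι → Fin (Module.finrank ℝ E) → ℕ)
        (a ψ : ι → (Fin (Module.finrank ℝ E) → ℝ) → ℝ)
        (P : ι → (Fin (Module.finrank ℝ E) → ℝ) → E),
        (∀ k, κ k ≠ 0) ∧ (∀ k j, 0 < w k j) ∧ (∀ k, Continuous (a k)) ∧ (∀ k y, 0 < a k y) ∧
        (∀ k, Continuous (ψ k)) ∧
        (∀ k, ∀ y ∈ Icc (0 : Fin (Module.finrank ℝ E) → ℝ) 1, 0 ≤ ψ k y) ∧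
        (∀ k, 0 < ψ k 0) ∧ (∀ k, Continuous (P k)) ∧ (∀ k, P k 0 = x) ∧
        ∀ σ : E → ℝ, Continuous σ → tsupport σ ⊆ W → (∀ z, 0 ≤ σ z) → ∀ t : ℝ, 0 < t →
          ∫ z in {z ∈ {x ∈ U | ∀ j, 0 ≤ g j x} | |f z| ≤ t}, σ z * φ z ∂μ =
            ∑ k, ∫ y in {y : Fin (Module.finrank ℝ E) → ℝ | a k y * ∏ j, y j ^ κ k j ≤ t},
              σ (P k y) * ψ k y ∂(Measure.pi fun j => powMeasure (w k j : ℝ)) := by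
  classical
  set D : ℕ := Module.finrank ℝ E with hDdef
  have hxU : x ∈ U := hx.1
  have hgx : ∀ j, 0 ≤ g j x := hx.2
  have hΩU : {x ∈ U | ∀ j, 0 ≤ g j x} ⊆ U := fun z hz => hz.1
  have hAm : ∀ t, MeasurableSet {z ∈ {x ∈ U | ∀ j, 0 ≤ g j x} | |f z| ≤ t} := fun t =>
    ((continuous_abs.comp_continuousOn (hf.continuousOn.mono hΩU)).preimage_isClosed_of_isClosed
      hΩc.isClosed isClosed_Iic (t := Iic t)).measurableSet
  have hN : ∀ᵐ z ∂μ, z ∉ {x ∈ U | (∀ j, 0 ≤ g j x) ∧ f x = 0} :=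
    measure_eq_zero_iff_ae_notMem.1 hnull
  ------------------------------------------------------------------
  -- Case 1: `f ≡ 0` near `x`: the empty family
  ------------------------------------------------------------------
  by_cases hzero : ∀ᶠ z in 𝓝 x, f z = 0
  · obtain ⟨W, hWf, hWo, hxW⟩ := _root_.eventually_nhds_iff.1 hzero
    refine ⟨W, hWo, hxW, PEmpty, inferInstance, fun k => k.elim, fun k => k.elim, fun k => k.elim,
      fun k => k.elim, fun k => k.elim, fun k => k.elim, fun k => k.elim, fun k => k.elim,
      fun k => k.elim, fun k => k.elim, fun k => k.elim, fun k => k.elim, fun k => k.elim,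
      fun k => k.elim, fun σ hσc hσW hσ0 t ht => ?_⟩
    rw [Fintype.sum_empty]
    refine integral_eq_zero_of_ae ?_
    filter_upwards [ae_restrict_mem (hAm t), ae_restrict_of_ae hN] with z hzA hzN
    show σ z * φ z = 0
    by_contra hne
    have hσz : σ z ≠ 0 := left_ne_zero_of_mul hne
    have hzW : z ∈ W := hσW (subset_tsupport _ hσz)
    exact hzN ⟨hzA.1.1, hzA.1.2, hWf z hzW⟩
  ------------------------------------------------------------------
  -- Case 2: `f ≢ 0` near `x`
  ------------------------------------------------------------------
  -- the active, non-trivial boundary inequalities at `x`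
  set J : Finset (Fin l) := Finset.univ.filter fun j => g j x = 0 ∧ ¬ ∀ᶠ z in 𝓝 x, g j z = 0
    with hJ
  have hJmem : ∀ j, j ∈ J ↔ g j x = 0 ∧ ¬ ∀ᶠ z in 𝓝 x, g j z = 0 := fun j => by simp [hJ]
  have hauto : ∀ᶠ z in 𝓝 x, ∀ j, j ∉ J → 0 ≤ g j z := by
    rw [eventually_all]
    intro j
    by_cases hj : j ∈ J
    · exact Eventually.of_forall fun z hj' => (hj' hj).elim
    · rw [hJmem, not_and_or] at hj
      rcases hj with hj | hj
      · have hpos : 0 < g j x := lt_of_le_of_ne (hgx j) (Ne.symm hj)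
        have hc : ContinuousAt (g j) x := (hg j x hxU).continuousAt
        filter_upwards [hc.preimage_mem_nhds (Ioi_mem_nhds hpos)] with z hz _
        exact le_of_lt hz
      · push Not at hj
        filter_upwards [hj] with z hz _
        exact hz.ge
  obtain ⟨r₀, hr₀, hball⟩ : ∃ r₀ > 0, ball x r₀ ⊆ U ∩ {z | ∀ j, j ∉ J → 0 ≤ g j z} :=
    Metric.mem_nhds_iff.1 (inter_mem (hU.mem_nhds hxU) hauto)
  have hballU : ball x r₀ ⊆ U := fun z hz => (hball hz).1
  have hballJ : ∀ z ∈ ball x r₀, ∀ j, j ∉ J → 0 ≤ g j z := fun z hz => (hball hz).2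
  -- affine coordinates `Ψ v = x + T⁻¹ v`
  set T : E ≃L[ℝ] (Fin D → ℝ) := (Module.finBasis ℝ E).equivFun.toContinuousLinearEquiv with hT
  set Ψ : (Fin D → ℝ) → E := fun v => x + T.symm v with hΨ
  have hΨc : Continuous Ψ := continuous_const.add T.symm.continuous
  have hΨ0 : Ψ 0 = x := by simp [hΨ]
  have hΨan : AnalyticOnNhd ℝ Ψ univ := fun v _ =>
    analyticAt_const.add ((T.symm : (Fin D → ℝ) →L[ℝ] E).analyticAt v)
  have hΨinv : ∀ z, Ψ (T (z - x)) = z := fun z => by simp [hΨ]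
  have hTΨ : ∀ v, T (Ψ v - x) = v := fun v => by simp [hΨ]
  set V : Set (Fin D → ℝ) := Ψ ⁻¹' ball x r₀ with hV
  have hVo : IsOpen V := isOpen_ball.preimage hΨc
  have h0V : (0 : Fin D → ℝ) ∈ V := by
    show Ψ 0 ∈ ball x r₀; rw [hΨ0]; exact mem_ball_self hr₀
  have hVeq : V = (T.symm : (Fin D → ℝ) → E) ⁻¹' ball 0 r₀ := by
    ext v; simp [hV, hΨ, dist_eq_norm]
  have hVc : IsPreconnected V := by
    rw [hVeq]
    exact ((convex_ball (0 : E) r₀).linear_preimage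
      (T.symm.toLinearEquiv : (Fin D → ℝ) →ₗ[ℝ] E)).isPreconnected
  have hVU : ∀ v ∈ V, Ψ v ∈ U := fun v hv => hballU hv
  have hVU' : MapsTo Ψ V U := fun v hv => hVU v hv
  -- the resolved family `(f, g_j or f) ∘ Ψ`
  set Fam : Fin (l + 1) → (Fin D → ℝ) → ℝ :=
    Fin.cons (fun v => f (Ψ v)) (fun j v => if j ∈ J then g j (Ψ v) else f (Ψ v)) with hFam
  have hFam0 : ∀ v, Fam 0 v = f (Ψ v) := fun v => by simp [hFam]
  have hFamJ : ∀ j ∈ J, ∀ v, Fam j.succ v = g j (Ψ v) := fun j hj v => by simp [hFam, hj]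
  have hFamJ' : ∀ j, j ∉ J → ∀ v, Fam j.succ v = f (Ψ v) := fun j hj v => by simp [hFam, hj]
  have hfΨ : AnalyticOnNhd ℝ (fun v => f (Ψ v)) V := hf.comp (hΨan.mono (subset_univ _)) hVU'
  have hFan : ∀ i, AnalyticOnNhd ℝ (Fam i) V := by
    refine Fin.cases ?_ (fun j => ?_)
    · have : Fam 0 = fun v => f (Ψ v) := funext hFam0
      rw [this]; exact hfΨ
    · by_cases hj : j ∈ J
      · have : Fam j.succ = fun v => g j (Ψ v) := funext (hFamJ j hj)
        rw [this]; exact (hg j).comp (hΨan.mono (subset_univ _)) hVU'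
      · have : Fam j.succ = fun v => f (Ψ v) := funext (hFamJ' j hj)
        rw [this]; exact hfΨ
  have hFa0 : ∀ i, Fam i 0 = 0 := by
    refine Fin.cases ?_ (fun j => ?_)
    · rw [hFam0, hΨ0, hfx]
    · by_cases hj : j ∈ J
      · rw [hFamJ j hj, hΨ0]; exact ((hJmem j).1 hj).1
      · rw [hFamJ' j hj, hΨ0, hfx]
  have hnc : ∀ q : E → ℝ, (¬ ∀ᶠ z in 𝓝 x, q z = 0) → ∃ v ∈ V, q (Ψ v) ≠ 0 := by
    intro q hq
    by_contra hall
    push Not at hall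
    apply hq
    filter_upwards [isOpen_ball.mem_nhds (mem_ball_self hr₀)] with z hz
    have := hall (T (z - x)) (by show Ψ (T (z - x)) ∈ ball x r₀; rw [hΨinv]; exact hz)
    rwa [hΨinv] at this
  have hFne : ∀ i, ∃ v ∈ V, Fam i v ≠ 0 := by
    refine Fin.cases ?_ (fun j => ?_)
    · simp only [hFam0]; exact hnc f hzero
    · by_cases hj : j ∈ J
      · simp only [hFamJ j hj]; exact hnc (g j) ((hJmem j).1 hj).2
      · simp only [hFamJ' j hj]; exact hnc f hzero
  -- Hironaka, the chart sum, the orthant pieces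
  have hFshape : ∀ i, (Fam i = fun v => f (x + T.symm v)) ∨
      ∃ j, Fam i = fun v => g j (x + T.symm v) := by
    refine Fin.cases ?_ (fun j => ?_)
    · exact Or.inl (funext hFam0)
    · by_cases hj : j ∈ J
      · exact Or.inr ⟨j, funext (hFamJ j hj)⟩
      · exact Or.inl (funext (hFamJ' j hj))
  obtain ⟨W, M, _, _, _, _, gres, hWo, h0W, hWV, hgW, hgan, hprop, hbij, hchart⟩ :=
    hRx T V Fam hVo hVc h0V hFan hFa0 hFne hFshape
  obtain ⟨r, hr, hrW, ι, _, δ, Pm, k, h, A, Jf, wt, hδ, hPmc, hPm0, hPmW, hAc, hA0, hJc, hJpos,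
    hwtc, hwt0, hwtpos, hmono, hsum⟩ :=
    exists_chartSum hVo hVc hFan hFne 0 (hFa0 0) hWo h0W hWV hgW hgan hprop hbij hchart
  have hPmU : ∀ n u, Ψ (Pm n u) ∈ U := fun n u => hVU _ (hWV (hPmW n u))
  have hPmball : ∀ n u, Ψ (Pm n u) ∈ ball x r₀ := fun n u => hWV (hPmW n u)
  set ρ : ι → (Fin D → ℝ) → ℝ := fun n u => max (φ (Ψ (Pm n u))) 0 * (wt n u * Jf n u) with hρ
  have hρc : ∀ n, Continuous (ρ n) := fun n =>
    ((hφ.continuousOn.comp_continuous (hΨc.comp (hPmc n)) (hPmU n)).max continuous_const).mul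
      ((hwtc n).mul (hJc n))
  have hρ0 : ∀ n u, 0 ≤ ρ n u := fun n u =>
    mul_nonneg (le_max_right _ _) (mul_nonneg (hwt0 n u) (hJpos n u).le)
  have hρpos : ∀ n, 0 < ρ n 0 := fun n => by
    simp only [hρ, hPm0, hΨ0]
    exact mul_pos (lt_max_of_lt_left (hφpos x hx)) (mul_pos (hwtpos n) (hJpos n 0))
  have hpieces := fun n : ι => chartIntegral_eq_sum_pieces (β := ↥J) (hδ n) (k n 0) (h n)
    (fun b => k n (Fin.succ b)) (af := A n 0) (ρ := ρ n) (aj := fun b => A n (Fin.succ b))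
    (hAc n 0) (hA0 n 0) (fun b => hAc n _) (fun b u => hA0 n _ u) (hρc n) (hρ0 n) (hρpos n)
  choose ιn instn An ψn Sn hAnc hAnpos hψnc hψn0 hψnpos hSnc hSn0 hSnδ hidn using hpieces
  letI : ∀ n, Fintype (ιn n) := instn
  obtain ⟨c, hc, hcint⟩ := exists_integral_eq_const_mul_integral_affine μ T x
  -- the neighbourhood and the Σ-indexed family of pieces
  set WE : Set E := {z | ‖T (z - x)‖ < r} with hWE
  have hWEo : IsOpen WE :=
    isOpen_lt (continuous_norm.comp (T.continuous.comp (continuous_id.sub continuous_const)))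
      continuous_const
  have hxWE : x ∈ WE := by simp [hWE, hr]
  have hk0 : ∀ n, k n 0 ≠ 0 := by
    intro n hk
    have h1 := hmono n 0 0 (by rw [norm_zero]; exact (hδ n).le)
    rw [hPm0, hFa0] at h1
    have : ∏ j, (0 : Fin D → ℝ) j ^ k n 0 j = 1 :=
      Finset.prod_eq_one fun j _ => by rw [show k n 0 j = 0 from congr_fun hk j, pow_zero]
    rw [this, mul_one] at h1
    exact hA0 n 0 0 h1.symm
  refine ⟨WE, hWEo, hxWE, (Σ n, ιn n), inferInstance, fun p => k p.1 0, fun p j => h p.1 j + 1,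
    fun p => An p.1 p.2, fun p y => c * ψn p.1 p.2 y, fun p y => Ψ (Pm p.1 (Sn p.1 p.2 y)),
    fun p => hk0 p.1, fun p j => Nat.succ_pos _, fun p => hAnc p.1 p.2, fun p y => hAnpos p.1 p.2 y,
    fun p => continuous_const.mul (hψnc p.1 p.2), fun p y _ => mul_nonneg hc.le (hψn0 p.1 p.2 y),
    fun p => mul_pos hc (hψnpos p.1 p.2), fun p => hΨc.comp ((hPmc p.1).comp (hSnc p.1 p.2)),
    fun p => by simp only [hSn0, hPm0, hΨ0], ?_⟩
  -- the identity
  intro σ hσc hσW hσ0 t ht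
  set Aset : Set E := {z ∈ {x ∈ U | ∀ j, 0 ≤ g j x} | |f z| ≤ t} with hAset
  -- (i) a measurable integrand on `E`
  set φm : E → ℝ := U.indicator φ with hφm
  have hφmeas : Measurable φm := measurable_indicator_of_continuousOn hU hφ.continuousOn
  have hφmU : ∀ z ∈ U, φm z = φ z := fun z hz => indicator_of_mem hz _
  set Gt : E → ℝ := Aset.indicator fun z => σ z * φm z with hGt
  have hGtm : Measurable Gt := (hσc.measurable.mul hφmeas).indicator (hAm t)
  have hLHS : ∫ z in Aset, σ z * φ z ∂μ = ∫ z, Gt z ∂μ := by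
    rw [hGt, integral_indicator (hAm t)]
    exact setIntegral_congr_fun (hAm t) fun z hz => by rw [hφmU z hz.1.1]
  obtain ⟨Bσ, hBσ⟩ := hΩc.exists_bound_of_continuousOn hσc.continuousOn
  obtain ⟨Bφ, hBφ⟩ := hΩc.exists_bound_of_continuousOn (hφ.continuousOn.mono hΩU)
  have hBσ0 : 0 ≤ Bσ := le_trans (norm_nonneg _) (hBσ x hx)
  have hBφ0 : 0 ≤ Bφ := le_trans (norm_nonneg _) (hBφ x hx)
  have hGtbd : ∀ z, |Gt z| ≤ Bσ * Bφ := by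
    intro z
    by_cases hz : z ∈ Aset
    · rw [hGt, indicator_of_mem hz, hφmU z hz.1.1, abs_mul]
      exact mul_le_mul (by simpa only [Real.norm_eq_abs] using hBσ z hz.1)
        (by simpa only [Real.norm_eq_abs] using hBφ z hz.1) (abs_nonneg _) hBσ0
    · rw [hGt, indicator_of_notMem hz, abs_zero]; exact mul_nonneg hBσ0 hBφ0
  -- (ii)+(iii) transport to `ℝ^D` and the chart sum
  set G : (Fin D → ℝ) → ℝ := fun v => Gt (Ψ v) with hG
  have hGm : Measurable G := hGtm.comp hΨc.measurable
  have hGsupp : ∀ v, G v ≠ 0 → ‖v‖ < r := by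
    intro v hv
    have h1 : σ (Ψ v) ≠ 0 := by
      intro h0; apply hv
      simp only [hG, hGt]
      by_cases hA : Ψ v ∈ Aset
      · rw [indicator_of_mem hA, h0, zero_mul]
      · rw [indicator_of_notMem hA]
    have h2 : Ψ v ∈ WE := hσW (subset_tsupport _ h1)
    have h3 : ‖T (Ψ v - x)‖ < r := h2
    rwa [hTΨ] at h3
  have hchain : ∫ z, Gt z ∂μ = c * ∑ n, ∫ u in ball (0 : Fin D → ℝ) (δ n),
      G (Pm n u) * (wt n u * (Jf n u * ∏ j, |u j| ^ h n j)) := by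
    rw [hcint Gt]
    exact congrArg (c * ·) (hsum G hGm ⟨Bσ * Bφ, fun v => hGtbd _⟩ hGsupp)
  -- (iv) each chart integral in normal-crossing form
  have hchartform : ∀ n, ∫ u in ball (0 : Fin D → ℝ) (δ n),
      G (Pm n u) * (wt n u * (Jf n u * ∏ j, |u j| ^ h n j)) =
      ∫ u in {u ∈ ball (0 : Fin D → ℝ) (δ n) |
          (∀ b : ↥J, 0 ≤ A n (Fin.succ b) u * ∏ j, u j ^ k n (Fin.succ b) j) ∧
          |A n 0 u * ∏ j, u j ^ k n 0 j| ≤ t},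
        σ (Ψ (Pm n u)) * ρ n u * ∏ j, |u j| ^ h n j := by
    intro n
    set Cn : Set (Fin D → ℝ) :=
      {u | ∀ b : ↥J, 0 ≤ A n (Fin.succ b) u * ∏ j, u j ^ k n (Fin.succ b) j} ∩
        {u | |A n 0 u * ∏ j, u j ^ k n 0 j| ≤ t} with hCn
    have hC1 : IsClosed {u : Fin D → ℝ | ∀ b : ↥J,
        0 ≤ A n (Fin.succ b) u * ∏ j, u j ^ k n (Fin.succ b) j} := by
      rw [setOf_forall]
      exact isClosed_iInter fun b => isClosed_le continuous_const
        ((hAc n _).mul (continuous_finsetProd _ fun j _ => (continuous_apply j).pow _))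
    have hC2 : IsClosed {u : Fin D → ℝ | |A n 0 u * ∏ j, u j ^ k n 0 j| ≤ t} :=
      isClosed_le (continuous_abs.comp ((hAc n 0).mul
        (continuous_finsetProd _ fun j _ => (continuous_apply j).pow _))) continuous_const
    have hCnm : MeasurableSet Cn := (hC1.inter hC2).measurableSet
    have hset : {u ∈ ball (0 : Fin D → ℝ) (δ n) |
        (∀ b : ↥J, 0 ≤ A n (Fin.succ b) u * ∏ j, u j ^ k n (Fin.succ b) j) ∧
        |A n 0 u * ∏ j, u j ^ k n 0 j| ≤ t} = ball 0 (δ n) ∩ Cn := by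
      ext u; simp only [hCn, mem_inter_iff, mem_setOf_eq]
    rw [hset, ← setIntegral_indicator hCnm]
    refine setIntegral_congr_fun isOpen_ball.measurableSet fun u hu => ?_
    have hun : ‖u‖ ≤ δ n := (mem_ball_zero_iff.1 hu).le
    have hzU : Ψ (Pm n u) ∈ U := hPmU n u
    have hfz : |f (Ψ (Pm n u))| = |A n 0 u * ∏ j, u j ^ k n 0 j| := by
      rw [← hFam0, hmono n 0 u hun]
    have hgz : ∀ b : ↥J, g b (Ψ (Pm n u)) = A n (Fin.succ b) u * ∏ j, u j ^ k n (Fin.succ b) j :=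
      fun b => by rw [← hFamJ b b.2, hmono n _ u hun]
    have hzA : Ψ (Pm n u) ∈ Aset ↔ u ∈ Cn := by
      constructor
      · rintro ⟨⟨-, hgall⟩, hft⟩
        refine ⟨fun b => ?_, ?_⟩
        · rw [← hgz b]; exact hgall b
        · have : |f (Ψ (Pm n u))| ≤ t := hft
          rwa [hfz] at this
      · rintro ⟨hb, hft⟩
        refine ⟨⟨hzU, fun j => ?_⟩, ?_⟩
        · by_cases hj : j ∈ J
          · have := hb ⟨j, hj⟩; rwa [← hgz ⟨j, hj⟩] at this
          · exact hballJ _ (hPmball n u) j hj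
        · show |f (Ψ (Pm n u))| ≤ t
          rw [hfz]; exact hft
    by_cases huC : u ∈ Cn
    · rw [indicator_of_mem huC]
      have hzA' : Ψ (Pm n u) ∈ Aset := hzA.2 huC
      have hφz : max (φ (Ψ (Pm n u))) 0 = φ (Ψ (Pm n u)) := max_eq_left (hφpos _ hzA'.1).le
      simp only [hG, hGt, indicator_of_mem hzA', hφmU _ hzU, hρ, hφz]
      ring
    · rw [indicator_of_notMem huC]
      have hzA' : Ψ (Pm n u) ∉ Aset := fun h' => huC (hzA.1 h')
      simp only [hG, hGt, indicator_of_notMem hzA', zero_mul]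
  -- (v)+(vi) assemble
  calc ∫ z in Aset, σ z * φ z ∂μ = ∫ z, Gt z ∂μ := hLHS
    _ = c * ∑ n, ∫ u in ball (0 : Fin D → ℝ) (δ n),
          G (Pm n u) * (wt n u * (Jf n u * ∏ j, |u j| ^ h n j)) := hchain
    _ = c * ∑ n, ∑ i, ∫ y in {y | An n i y * ∏ j, y j ^ k n 0 j ≤ t},
          σ (Ψ (Pm n (Sn n i y))) * ψn n i y
            ∂(Measure.pi fun j => powMeasure (((h n j + 1 : ℕ) : ℝ))) := by
        congr 1
        refine Finset.sum_congr rfl fun n _ => ?_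
        rw [hchartform n]
        exact hidn n (fun u => σ (Ψ (Pm n u))) (hσc.comp (hΨc.comp (hPmc n))) t
    _ = ∑ p : (Σ n, ιn n), ∫ y in {y | An p.1 p.2 y * ∏ j, y j ^ k p.1 0 j ≤ t},
          σ (Ψ (Pm p.1 (Sn p.1 p.2 y))) * (c * ψn p.1 p.2 y)
            ∂(Measure.pi fun j => powMeasure (((h p.1 j + 1 : ℕ) : ℝ))) := by
        rw [Finset.mul_sum, Fintype.sum_sigma]
        refine Finset.sum_congr rfl fun n _ => ?_
        rw [Finset.mul_sum]
        refine Finset.sum_congr rfl fun i _ => ?_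
        rw [← integral_const_mul]
        exact integral_congr_ae (ae_of_all _ fun y => by ring)

/-- **Leading-term asymptotics of a Laplace integral with analytic phase, from the
monomialization of ITS sublevel volumes** — the pointwise (fixed-data) form of the tree's
`laplaceAsymptotics_of_monomialization`: same proof (dominant scale of the monomial pieces and
the Abelian theorem when `μ(Ω ∩ f⁻¹0) = 0`, the degenerate case `λ = 0` otherwise), the
monomialization being demanded only for the given `(E, μ, U, f, g, φ)`.
[cite: Lin2017, Thm. 2.2, Cor. 2.3, Lemma 2.4, Prop. 2.5, Thm. 2.9]
[cite: ArnoldGuseinzadeVarchenko2012, Part II §7.3] -/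
theorem laplaceAsymptotics_at
    {E : Type} [NormedAddCommGroup E] [NormedSpace ℝ E] [FiniteDimensional ℝ E]
    [MeasurableSpace E] [BorelSpace E] (μ : Measure E) [μ.IsAddHaarMeasure]
    (hd : 0 < Module.finrank ℝ E) {U : Set E} {f : E → ℝ} {l : ℕ} {g : Fin l → E → ℝ} {φ : E → ℝ}
    (hU : IsOpen U) (hf : AnalyticOnNhd ℝ f U) (hφ : ContDiffOn ℝ ∞ φ U)
    (hΩ : IsCompact {x ∈ U | ∀ j, 0 ≤ g j x}) (hφpos : ∀ x ∈ {x ∈ U | ∀ j, 0 ≤ g j x}, 0 < φ x)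
    (hzero : ∃ x₀ ∈ interior {x ∈ U | ∀ j, 0 ≤ g j x}, f x₀ = 0)
    (hRd : μ {x ∈ U | (∀ j, 0 ≤ g j x) ∧ f x = 0} = 0 →
      ∃ (ι : Type) (_ : Fintype ι) (κ w : ι → Fin (Module.finrank ℝ E) → ℕ)
        (a ψ : ι → (Fin (Module.finrank ℝ E) → ℝ) → ℝ) (t₀ : ℝ),
        (∀ i, κ i ≠ 0) ∧ (∀ i j, 0 < w i j) ∧ (∀ i, Continuous (a i)) ∧ (∀ i x, 0 < a i x) ∧
        (∀ i, Continuous (ψ i)) ∧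
        (∀ i, ∀ x ∈ Icc (0 : Fin (Module.finrank ℝ E) → ℝ) 1, 0 ≤ ψ i x) ∧
        (∀ i, 0 < ψ i 0) ∧ 0 < t₀ ∧
        ∀ t ∈ Ioo (0 : ℝ) t₀, ∫ x in {x ∈ U | (∀ j, 0 ≤ g j x) ∧ |f x| ≤ t}, φ x ∂μ =
          ∑ i, ∫ y in {y : Fin (Module.finrank ℝ E) → ℝ | a i y * ∏ j, y j ^ κ i j ≤ t},
            ψ i y ∂(Measure.pi fun j => powMeasure (w i j : ℝ))) :
    ∃ (C : ℝ) (lam : ℚ) (m : ℕ), 0 < C ∧ 0 ≤ lam ∧ m < Module.finrank ℝ E ∧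
      Tendsto (fun τ : ℝ => τ ^ (lam : ℝ) / Real.log τ ^ m *
          ∫ x in {x ∈ U | ∀ j, 0 ≤ g j x}, Real.exp (-(τ * |f x|)) * φ x ∂μ)
        atTop (𝓝 C) := by
  obtain ⟨x₀, hx₀, hfx₀⟩ := hzero
  set Ω : Set E := {x ∈ U | ∀ j, 0 ≤ g j x} with hΩdef
  have hΩU : Ω ⊆ U := fun x hx => hx.1
  have hfc : ContinuousOn f U := hf.continuousOn
  have hφc : ContinuousOn φ U := hφ.continuousOn
  have hφ0 : ∀ x ∈ Ω, 0 ≤ φ x := fun x hx => (hφpos x hx).le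
  have hAeq : {x ∈ U | (∀ j, 0 ≤ g j x) ∧ f x = 0} = {x ∈ Ω | f x = 0} := by
    ext x
    simp only [hΩdef, mem_setOf_eq, and_assoc]
  have hVeq : ∀ t : ℝ, {x ∈ U | (∀ j, 0 ≤ g j x) ∧ |f x| ≤ t} = {x ∈ Ω | |f x| ≤ t} := by
    intro t
    ext x
    simp only [hΩdef, mem_setOf_eq, and_assoc]
  by_cases hA : μ {x ∈ U | (∀ j, 0 ≤ g j x) ∧ f x = 0} = 0
  · -- non-degenerate case: monomialization of the sublevel volumes
    obtain ⟨ι, _, κ, w, a, ψ, t₀, hκ, hw, ha, ha0, hψc, hψ0, hψpos, ht₀, hV⟩ :=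
      hRd hA
    -- the family of pieces is non-empty, because the sublevel integrals are positive
    haveI : Nonempty ι := by
      by_contra hι
      haveI : IsEmpty ι := not_nonempty_iff.1 hι
      have h1 := hV (t₀ / 2) ⟨by linarith, by linarith⟩
      rw [hVeq, Finset.univ_eq_empty, Finset.sum_empty] at h1
      have h2 := setIntegral_sublevel_pos (μ := μ) hU hfc hφc hΩ hΩU hφ0 hx₀ hfx₀
        (hφpos x₀ (interior_subset hx₀)) (half_pos ht₀)
      linarith
    obtain ⟨C, lam, θ, hC, hlam, hθ1, hθd, hlim⟩ := tendsto_of_monomialPieces κ w a ψ hκ hw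
      ha ha0 hψc hψ0 hψpos (V := fun t => ∫ x in {x ∈ Ω | |f x| ≤ t}, φ x ∂μ) ht₀
      (fun t ht1 ht2 => by
        show ∫ x in {x ∈ Ω | |f x| ≤ t}, φ x ∂μ = _
        rw [← hVeq]
        exact hV t ⟨ht1, ht2⟩)
    have hlap := tendsto_laplace_of_sublevel (μ := μ) hU hfc hφc hΩ hΩU hφ0
      (show (0 : ℝ) ≤ (lam : ℝ) by exact_mod_cast hlam.le) hlim
    refine ⟨C * Real.Gamma ((lam : ℝ) + 1), lam, θ - 1,
      mul_pos hC (Real.Gamma_pos_of_pos (by positivity)), hlam.le, by omega, hlap⟩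
  · -- degenerate case: `λ = 0`, no resolution needed
    have hApos : 0 < μ {x ∈ Ω | f x = 0} := by
      rw [← hAeq]
      exact pos_iff_ne_zero.2 hA
    have hAc : IsClosed {x ∈ Ω | f x = 0} :=
      (hfc.mono hΩU).preimage_isClosed_of_isClosed hΩ.isClosed isClosed_singleton (t := {0})
    have hint : IntegrableOn φ {x ∈ Ω | f x = 0} μ :=
      ((hφc.mono hΩU).integrableOn_compact hΩ).mono_set fun x hx => hx.1
    have hV₀ : 0 < ∫ x in {x ∈ Ω | f x = 0}, φ x ∂μ := by
      rw [setIntegral_pos_iff_support_of_nonneg_ae]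
      · have h : Function.support φ ∩ {x ∈ Ω | f x = 0} = {x ∈ Ω | f x = 0} :=
          inter_eq_right.2 fun x hx => Function.mem_support.2 (hφpos x hx.1).ne'
        rwa [h]
      · rw [EventuallyLE, ae_restrict_iff' hAc.measurableSet]
        exact ae_of_all _ fun x hx => hφ0 x hx.1
      · exact hint
    refine ⟨∫ x in {x ∈ Ω | f x = 0}, φ x ∂μ, 0, 0, hV₀, le_rfl, hd, ?_⟩
    have h := tendsto_laplace_of_zeroSet (μ := μ) hfc hφc hΩ hΩU
    refine h.congr' (Eventually.of_forall fun τ => ?_)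
    simp

/-- **Leading-term Laplace asymptotics from resolution data at the zeros of the phase.** For
`E` of dimension `D ≥ 1` with an additive Haar measure, `f, gⱼ` analytic and `φ` smooth on an
open `U`, `Ω = {gⱼ ≥ 0} ⊆ U` compact with `φ > 0` on `Ω` and `f` vanishing at an interior point of
`Ω`: if at every zero `x ∈ Ω` of `f` the families `(f, gⱼ or f) ∘ (v ↦ x + T⁻¹ v)` admit
resolution data (hypothesis `hRx` of `localMonomialization_at`), then
`τ^λ (log τ)^{-m} ∫_Ω e^{-τ|f|} φ dμ → C` for some `C > 0`, rational `λ ≥ 0`, `m < D`.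
[cite: Lin2017, Thm. 2.2, Cor. 2.3, Lemma 2.4, Thm. 2.9]
[cite: ArnoldGuseinzadeVarchenko2012, Part II §7.3 Thm. 7.5, Thm. 7.6] -/
theorem laplaceAsymptotics_of_localResolution
    {E : Type} [NormedAddCommGroup E] [NormedSpace ℝ E] [FiniteDimensional ℝ E]
    [MeasurableSpace E] [BorelSpace E] (μ : Measure E) [μ.IsAddHaarMeasure]
    (hd : 0 < Module.finrank ℝ E) {U : Set E} {f : E → ℝ} {l : ℕ} {g : Fin l → E → ℝ} {φ : E → ℝ}
    (hU : IsOpen U) (hf : AnalyticOnNhd ℝ f U) (hg : ∀ j, AnalyticOnNhd ℝ (g j) U)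
    (hφ : ContDiffOn ℝ ∞ φ U) (hΩc : IsCompact {x ∈ U | ∀ j, 0 ≤ g j x})
    (hφpos : ∀ x ∈ {x ∈ U | ∀ j, 0 ≤ g j x}, 0 < φ x)
    (hzero : ∃ x₀ ∈ interior {x ∈ U | ∀ j, 0 ≤ g j x}, f x₀ = 0)
    (hRx : ∀ x ∈ {x ∈ U | ∀ j, 0 ≤ g j x}, f x = 0 →
      ∀ (T : E ≃L[ℝ] (Fin (Module.finrank ℝ E) → ℝ)) (V : Set (Fin (Module.finrank ℝ E) → ℝ))
      (F : Fin (l + 1) → (Fin (Module.finrank ℝ E) → ℝ) → ℝ),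
      IsOpen V → IsPreconnected V → (0 : Fin (Module.finrank ℝ E) → ℝ) ∈ V →
      (∀ i, AnalyticOnNhd ℝ (F i) V) → (∀ i, F i 0 = 0) → (∀ i, ∃ v ∈ V, F i v ≠ 0) →
      (∀ i, (F i = fun v => f (x + T.symm v)) ∨ ∃ j, F i = fun v => g j (x + T.symm v)) →
      ∃ (W : Set (Fin (Module.finrank ℝ E) → ℝ)) (M : Type) (_ : TopologicalSpace M) (_ : T2Space M)
        (_ : ChartedSpace (Fin (Module.finrank ℝ E) → ℝ) M)
        (_ : IsManifold 𝓘(ℝ, Fin (Module.finrank ℝ E) → ℝ) ω M)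
        (gr : M → (Fin (Module.finrank ℝ E) → ℝ)),
        IsOpen W ∧ (0 : Fin (Module.finrank ℝ E) → ℝ) ∈ W ∧ W ⊆ V ∧ (∀ p, gr p ∈ W) ∧
        ContMDiff 𝓘(ℝ, Fin (Module.finrank ℝ E) → ℝ) 𝓘(ℝ, Fin (Module.finrank ℝ E) → ℝ) ω gr ∧
        (∀ K ⊆ W, IsCompact K → IsCompact (gr ⁻¹' K)) ∧
        Set.BijOn gr {p | ∀ i, F i (gr p) ≠ 0} {x ∈ W | ∀ i, F i x ≠ 0} ∧
        ∀ p : M, (∃ i, F i (gr p) = 0) →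
          ∃ ch : OpenPartialHomeomorph M (Fin (Module.finrank ℝ E) → ℝ),
            ch ∈ IsManifold.maximalAtlas 𝓘(ℝ, Fin (Module.finrank ℝ E) → ℝ) ω M ∧
            p ∈ ch.source ∧ ch p = 0 ∧
            ∃ (k : Fin (l + 1) → Fin (Module.finrank ℝ E) → ℕ) (h : Fin (Module.finrank ℝ E) → ℕ)
              (a : Fin (l + 1) → (Fin (Module.finrank ℝ E) → ℝ) → ℝ)
              (b : (Fin (Module.finrank ℝ E) → ℝ) → ℝ),
              (∀ i, AnalyticOnNhd ℝ (a i) ch.target) ∧ AnalyticOnNhd ℝ b ch.target ∧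
              (∀ i, ∀ u ∈ ch.target, a i u ≠ 0) ∧ (∀ u ∈ ch.target, b u ≠ 0) ∧
              (∀ i, ∀ u ∈ ch.target, F i (gr (ch.symm u)) = a i u * ∏ j, u j ^ k i j) ∧
              (∀ u ∈ ch.target, (fderiv ℝ (gr ∘ ch.symm) u).det = b u * ∏ j, u j ^ h j)) :
    ∃ (C : ℝ) (lam : ℚ) (m : ℕ), 0 < C ∧ 0 ≤ lam ∧ m < Module.finrank ℝ E ∧
      Tendsto (fun τ : ℝ => τ ^ (lam : ℝ) / Real.log τ ^ m *
          ∫ x in {x ∈ U | ∀ j, 0 ≤ g j x}, Real.exp (-(τ * |f x|)) * φ x ∂μ)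
        atTop (𝓝 C) := by
  refine laplaceAsymptotics_at μ hd hU hf hφ hΩc hφpos hzero fun hA => ?_
  obtain ⟨ι, hι, κ, w, a, ψ, t₀, h1, h2, h3, h4, h5, h6, h7, h8, h9⟩ :=
    exists_monomialPieces_of_local (μ := μ) (d := Module.finrank ℝ E) hU hf.continuousOn
      hφ.continuousOn hΩc (fun x hx => hx.1)
      (fun x hx hfx => localMonomialization_at μ hU hf hg hφ hΩc hφpos hA hx hfx (hRx x hx hfx))
  refine ⟨ι, hι, κ, w, a, ψ, t₀, h1, h2, h3, h4, h5, h6, h7, h8, fun t ht => ?_⟩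
  have hset : {z ∈ U | (∀ j, 0 ≤ g j z) ∧ |f z| ≤ t} =
      {z ∈ {x ∈ U | ∀ j, 0 ≤ g j x} | |f z| ≤ t} := by
    ext z
    simp only [mem_setOf_eq, and_assoc]
  rw [hset]
  exact h9 t ht

end Local

end Literature.MathematicalPhysics.QuantumFieldTheory

end
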